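import Summits.CriticalPhenomena.PercolationContinuityZ3.Theorems.PercNearOneGluingNoHeavyLowerTailSunflowerVertexFibre

/-!
# Box fibre lemmas for the boxed-exemption criterion of (RES0′), part 2 (tied fibres)

(prove-1 gen 58, memo FINDING-BOXED-prove1-g58.md; model and inequality as in part 1, `…SunflowerBoxFibresA`.)  The tied fibres
`k = g` (at `y = α₀₀`), `k = g = h` (at `y = α₀₀`), `y = k = g`, the main diagonal and `g = h`, with general endpoints `[m₀,m₁]` and
constant `C`.  The root conditions that need the leaf-leaf constant `c₀ ≥ τσ + (1−τ)(1−s)α₀₀` sit on `(α₀₀,t,t,h)` and `(α₀₀,t,t,t)`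
(this is why `y` is never boxed: a lower bound `y ≥ y₀ > α₀₀` would break the Ȳ root condition on the `k = g` fibre). [this work]
-/

namespace Summit.CriticalPhenomena.PercolationContinuityZ3.Theorems.SunflowerPartition.SafeCalc.LinkedCurrency

section BoxFibresB

variable {τ σ s α00 α01 α11 c0 C ly lk lg lh lX lH : ℝ}

/- Standing hypotheses of the box fibre lemmas: parameters (all coins in `(0,1)`), floors, the leaf-leaf lower bound on `c₀`,
nonnegative exponents, and a positive constant `C` (= `g·e^z` in the boxed criterion). -/
variable (hP : 0 < τ ∧ τ < 1 ∧ 0 < σ ∧ σ < 1 ∧ 0 < s ∧ s < 1 ∧ 0 < α00 ∧ α00 ≤ α01 ∧ α01 ≤ α11 ∧ α11 ≤ 1 ∧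
      τ * σ + (1 - τ) * (1 - s) * α00 ≤ c0 ∧ 0 ≤ ly ∧ 0 ≤ lk ∧ 0 ≤ lg ∧ 0 ≤ lh ∧ 0 ≤ lX ∧ 0 ≤ lH ∧ 0 < C)

include hP

/-- Box tied fibre `k = g` at `y = α₀₀`: petal `(α₀₀,t,t,h)`, `t ∈ [m₀, m₁]`, `m₀ > 0`, `h ≤ 1` (varying: `k`, `g`, Ȳ, H; needs `c₀ ≥ τσ + (1−τ)(1−s)α₀₀`). [this work] -/
theorem bfib_kg :
    ∀ h m0 m1 : ℝ, α11 ≤ h → h ≤ 1 → 0 < m0 →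
      (c0 + τ * (1 - σ) * ((1 - s) * α00 + s * m0) + s * (1 - τ) * ((1 - σ) * m0 + σ * h)) ≤ C * (α00 / α00) ^ ly * (m0 / α01) ^ lk * (m0 / α01) ^ lg * (h / α11) ^ lh * (((1 - s) * α00 + s * m0) / ((1 - s) * α00 + s * α01)) ^ lX * (((1 - σ) * m0 + σ * h) / ((1 - σ) * α01 + σ * α11)) ^ lH →
      (c0 + τ * (1 - σ) * ((1 - s) * α00 + s * m1) + s * (1 - τ) * ((1 - σ) * m1 + σ * h)) ≤ C * (α00 / α00) ^ ly * (m1 / α01) ^ lk * (m1 / α01) ^ lg * (h / α11) ^ lh * (((1 - s) * α00 + s * m1) / ((1 - s) * α00 + s * α01)) ^ lX * (((1 - σ) * m1 + σ * h) / ((1 - σ) * α01 + σ * α11)) ^ lH →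
      ∀ t : ℝ, m0 ≤ t → t ≤ m1 → (c0 + τ * (1 - σ) * ((1 - s) * α00 + s * t) + s * (1 - τ) * ((1 - σ) * t + σ * h)) ≤ C * (α00 / α00) ^ ly * (t / α01) ^ lk * (t / α01) ^ lg * (h / α11) ^ lh * (((1 - s) * α00 + s * t) / ((1 - s) * α00 + s * α01)) ^ lX * (((1 - σ) * t + σ * h) / ((1 - σ) * α01 + σ * α11)) ^ lH := by
  obtain ⟨hτ0, hτ1, hσ0, hσ1, hs0, hs1, hα00, h01, h11, hα1, hc0, hly, hlk, hlg, hlh, hlX, hlH, hC0⟩ := hP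
  have hα01 : 0 < α01 := lt_of_lt_of_le hα00 h01
  have hα11 : 0 < α11 := lt_of_lt_of_le hα01 h11
  have h1σ : 0 < 1 - σ := sub_pos.2 hσ1
  have h1s : 0 < 1 - s := sub_pos.2 hs1
  have h1τ : 0 < 1 - τ := sub_pos.2 hτ1
  have hp0 : 0 < τ * (1 - σ) := mul_pos hτ0 h1σ
  have hq0 : 0 < s * (1 - τ) := mul_pos hs0 h1τ
  have hbY : 0 < ((1 - s) * α00 + s * α01) := add_pos (mul_pos h1s hα00) (mul_pos hs0 hα01)
  have hbH : 0 < ((1 - σ) * α01 + σ * α11) := add_pos (mul_pos h1σ hα01) (mul_pos hσ0 hα11)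
  have hτσ0 : 0 ≤ τ * σ := mul_nonneg hτ0.le hσ0.le
  have hπ0 : 0 ≤ (1 - τ) * (1 - s) * α00 := mul_nonneg (mul_nonneg h1τ.le h1s.le) hα00.le
  have hc0' : 0 ≤ c0 := le_trans (add_nonneg hτσ0 hπ0) hc0
  have hcτσ : τ * σ ≤ c0 := le_trans (le_add_of_nonneg_right hπ0) hc0
  have hcd : 0 ≤ c0 - (τ * σ + (1 - τ) * (1 - s) * α00) := sub_nonneg.2 hc0
  have hα1' : α11 ≤ 1 := hα1
  have h1s1 : (1 - s) + s = 1 := by ring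
  have h1σ1 : (1 - σ) + σ = 1 := by ring
  intro h m0 m1 hh hh1 hm0 h0 h1 t ht0 ht1
  have hhp : 0 < h := lt_of_lt_of_le hα11 hh
  have hh0 : 0 ≤ h := hhp.le
  have hsh : s * h ≤ 1 := by nlinarith [mul_le_mul_of_nonneg_left hh1 hs0.le]
  have hA : 0 ≤ (c0 + τ * (1 - σ) * ((1 - s) * α00) + s * (1 - τ) * (σ * h)) := add_nonneg (add_nonneg hc0' (mul_nonneg hp0.le (mul_nonneg h1s.le hα00.le))) (mul_nonneg hq0.le (mul_nonneg hσ0.le hh0))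
  have hB : 0 < (τ * (1 - σ) * s + s * (1 - τ) * (1 - σ)) := add_pos (mul_pos hp0 hs0) (mul_pos hq0 h1σ)
  have hb1 : (0:ℝ) ≤ 0 := le_rfl
  have hp1 : 0 < 0 * m0 + α00 := by rw [zero_mul, zero_add]; exact hα00
  have hr1 : (0:ℝ) = 0 ∨ α00 * (τ * (1 - σ) * s + s * (1 - τ) * (1 - σ)) ≤ (c0 + τ * (1 - σ) * ((1 - s) * α00) + s * (1 - τ) * (σ * h)) * 0 := Or.inl rfl
  have hb2 : (0:ℝ) ≤ 1 := zero_le_one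
  have hp2 : 0 < 1 * m0 + 0 := by rw [one_mul, add_zero]; exact hm0
  have hr2 : (1:ℝ) = 0 ∨ 0 * (τ * (1 - σ) * s + s * (1 - τ) * (1 - σ)) ≤ (c0 + τ * (1 - σ) * ((1 - s) * α00) + s * (1 - τ) * (σ * h)) * 1 := Or.inr (by rw [zero_mul]; exact mul_nonneg hA hb2)
  have hb3 : (0:ℝ) ≤ 1 := zero_le_one
  have hp3 : 0 < 1 * m0 + 0 := by rw [one_mul, add_zero]; exact hm0
  have hr3 : (1:ℝ) = 0 ∨ 0 * (τ * (1 - σ) * s + s * (1 - τ) * (1 - σ)) ≤ (c0 + τ * (1 - σ) * ((1 - s) * α00) + s * (1 - τ) * (σ * h)) * 1 := Or.inr (by rw [zero_mul]; exact mul_nonneg hA hb3)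
  have hb4 : (0:ℝ) ≤ 0 := le_rfl
  have hp4 : 0 < 0 * m0 + h := by rw [zero_mul, zero_add]; exact hhp
  have hr4 : (0:ℝ) = 0 ∨ h * (τ * (1 - σ) * s + s * (1 - τ) * (1 - σ)) ≤ (c0 + τ * (1 - σ) * ((1 - s) * α00) + s * (1 - τ) * (σ * h)) * 0 := Or.inl rfl
  have hb5 : (0:ℝ) ≤ s := hs0.le
  have hp5 : 0 < s * m0 + (1 - s) * α00 := add_pos (mul_pos hs0 hm0) (mul_pos h1s hα00)
  have hr5 : (s:ℝ) = 0 ∨ (1 - s) * α00 * (τ * (1 - σ) * s + s * (1 - τ) * (1 - σ)) ≤ (c0 + τ * (1 - σ) * ((1 - s) * α00) + s * (1 - τ) * (σ * h)) * s := Or.inr (sub_nonneg.1 (by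
    have e : (c0 + τ * (1 - σ) * ((1 - s) * α00) + s * (1 - τ) * (σ * h)) * s - (1 - s) * α00 * (τ * (1 - σ) * s + s * (1 - τ) * (1 - σ)) = s * ((c0 - (τ * σ + (1 - τ) * (1 - s) * α00)) + τ * σ + (1 - τ) * (1 - s) * α00 * σ + s * (1 - τ) * σ * h) := by ring
    rw [e]; exact mul_nonneg hs0.le (add_nonneg (add_nonneg (add_nonneg hcd hτσ0) (mul_nonneg hπ0 hσ0.le)) (mul_nonneg (mul_nonneg hq0.le hσ0.le) hh0))))
  have hb6 : (0:ℝ) ≤ (1 - σ) := h1σ.le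
  have hp6 : 0 < (1 - σ) * m0 + σ * h := add_pos (mul_pos h1σ hm0) (mul_pos hσ0 hhp)
  have hr6 : ((1 - σ):ℝ) = 0 ∨ σ * h * (τ * (1 - σ) * s + s * (1 - τ) * (1 - σ)) ≤ (c0 + τ * (1 - σ) * ((1 - s) * α00) + s * (1 - τ) * (σ * h)) * (1 - σ) := Or.inr (sub_nonneg.1 (by
    have e : (c0 + τ * (1 - σ) * ((1 - s) * α00) + s * (1 - τ) * (σ * h)) * (1 - σ) - σ * h * (τ * (1 - σ) * s + s * (1 - τ) * (1 - σ)) = (1 - σ) * ((c0 - τ * σ) + τ * σ * (1 - s * h) + τ * (1 - σ) * (1 - s) * α00) := by ring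
    rw [e]; exact mul_nonneg h1σ.le (add_nonneg (add_nonneg (sub_nonneg.2 hcτσ) (mul_nonneg hτσ0 (sub_nonneg.2 hsh))) (mul_nonneg (mul_nonneg hp0.le h1s.le) hα00.le))))
  have e0 : (c0 + τ * (1 - σ) * ((1 - s) * α00) + s * (1 - τ) * (σ * h)) + (τ * (1 - σ) * s + s * (1 - τ) * (1 - σ)) * m0 ≤ C * ((0 * m0 + α00) / α00) ^ ly * ((1 * m0 + 0) / α01) ^ lk * ((1 * m0 + 0) / α01) ^ lg * ((0 * m0 + h) / α11) ^ lh * ((s * m0 + (1 - s) * α00) / ((1 - s) * α00 + s * α01)) ^ lX * (((1 - σ) * m0 + σ * h) / ((1 - σ) * α01 + σ * α11)) ^ lH := by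
    rw [show (0 * m0 + α00 : ℝ) = α00 by ring, show (1 * m0 + 0 : ℝ) = m0 by ring, show (0 * m0 + h : ℝ) = h by ring, show (s * m0 + (1 - s) * α00 : ℝ) = (1 - s) * α00 + s * m0 by ring, show (c0 + τ * (1 - σ) * ((1 - s) * α00) + s * (1 - τ) * (σ * h)) + (τ * (1 - σ) * s + s * (1 - τ) * (1 - σ)) * m0 = (c0 + τ * (1 - σ) * ((1 - s) * α00 + s * m0) + s * (1 - τ) * ((1 - σ) * m0 + σ * h)) by ring]
    exact h0
  have e1 : (c0 + τ * (1 - σ) * ((1 - s) * α00) + s * (1 - τ) * (σ * h)) + (τ * (1 - σ) * s + s * (1 - τ) * (1 - σ)) * m1 ≤ C * ((0 * m1 + α00) / α00) ^ ly * ((1 * m1 + 0) / α01) ^ lk * ((1 * m1 + 0) / α01) ^ lg * ((0 * m1 + h) / α11) ^ lh * ((s * m1 + (1 - s) * α00) / ((1 - s) * α00 + s * α01)) ^ lX * (((1 - σ) * m1 + σ * h) / ((1 - σ) * α01 + σ * α11)) ^ lH := by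
    rw [show (0 * m1 + α00 : ℝ) = α00 by ring, show (1 * m1 + 0 : ℝ) = m1 by ring, show (0 * m1 + h : ℝ) = h by ring, show (s * m1 + (1 - s) * α00 : ℝ) = (1 - s) * α00 + s * m1 by ring, show (c0 + τ * (1 - σ) * ((1 - s) * α00) + s * (1 - τ) * (σ * h)) + (τ * (1 - σ) * s + s * (1 - τ) * (1 - σ)) * m1 = (c0 + τ * (1 - σ) * ((1 - s) * α00 + s * m1) + s * (1 - τ) * ((1 - σ) * m1 + σ * h)) by ring]
    exact h1
  have key := affine_le_prod6_rpow_of_endpoints hA hB hC0.le hm0 ht0 ht1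
    hb1 hα00 hly hp1 hr1 hb2 hα01 hlk hp2 hr2 hb3 hα01 hlg hp3 hr3
    hb4 hα11 hlh hp4 hr4 hb5 hbY hlX hp5 hr5 hb6 hbH hlH hp6 hr6 e0 e1
  rw [show (0 * t + α00 : ℝ) = α00 by ring, show (1 * t + 0 : ℝ) = t by ring, show (0 * t + h : ℝ) = h by ring, show (s * t + (1 - s) * α00 : ℝ) = (1 - s) * α00 + s * t by ring, show (c0 + τ * (1 - σ) * ((1 - s) * α00) + s * (1 - τ) * (σ * h)) + (τ * (1 - σ) * s + s * (1 - τ) * (1 - σ)) * t = (c0 + τ * (1 - σ) * ((1 - s) * α00 + s * t) + s * (1 - τ) * ((1 - σ) * t + σ * h)) by ring] at key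
  exact key

/-- Box tied fibre `k = g = h` at `y = α₀₀` (leverage diagonal): petal `(α₀₀,t,t,t)`, `t ∈ [m₀, m₁]`, `m₀ > 0` (varying: `k,g,h`, Ȳ, H; needs `c₀ ≥ τσ + (1−τ)(1−s)α₀₀`). [this work] -/
theorem bfib_kgh :
    ∀ m0 m1 : ℝ, 0 < m0 →
      (c0 + τ * (1 - σ) * ((1 - s) * α00 + s * m0) + s * (1 - τ) * ((1 - σ) * m0 + σ * m0)) ≤ C * (α00 / α00) ^ ly * (m0 / α01) ^ lk * (m0 / α01) ^ lg * (m0 / α11) ^ lh * (((1 - s) * α00 + s * m0) / ((1 - s) * α00 + s * α01)) ^ lX * (((1 - σ) * m0 + σ * m0) / ((1 - σ) * α01 + σ * α11)) ^ lH →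
      (c0 + τ * (1 - σ) * ((1 - s) * α00 + s * m1) + s * (1 - τ) * ((1 - σ) * m1 + σ * m1)) ≤ C * (α00 / α00) ^ ly * (m1 / α01) ^ lk * (m1 / α01) ^ lg * (m1 / α11) ^ lh * (((1 - s) * α00 + s * m1) / ((1 - s) * α00 + s * α01)) ^ lX * (((1 - σ) * m1 + σ * m1) / ((1 - σ) * α01 + σ * α11)) ^ lH →
      ∀ t : ℝ, m0 ≤ t → t ≤ m1 → (c0 + τ * (1 - σ) * ((1 - s) * α00 + s * t) + s * (1 - τ) * ((1 - σ) * t + σ * t)) ≤ C * (α00 / α00) ^ ly * (t / α01) ^ lk * (t / α01) ^ lg * (t / α11) ^ lh * (((1 - s) * α00 + s * t) / ((1 - s) * α00 + s * α01)) ^ lX * (((1 - σ) * t + σ * t) / ((1 - σ) * α01 + σ * α11)) ^ lH := by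
  obtain ⟨hτ0, hτ1, hσ0, hσ1, hs0, hs1, hα00, h01, h11, hα1, hc0, hly, hlk, hlg, hlh, hlX, hlH, hC0⟩ := hP
  have hα01 : 0 < α01 := lt_of_lt_of_le hα00 h01
  have hα11 : 0 < α11 := lt_of_lt_of_le hα01 h11
  have h1σ : 0 < 1 - σ := sub_pos.2 hσ1
  have h1s : 0 < 1 - s := sub_pos.2 hs1
  have h1τ : 0 < 1 - τ := sub_pos.2 hτ1
  have hp0 : 0 < τ * (1 - σ) := mul_pos hτ0 h1σ
  have hq0 : 0 < s * (1 - τ) := mul_pos hs0 h1τ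
  have hbY : 0 < ((1 - s) * α00 + s * α01) := add_pos (mul_pos h1s hα00) (mul_pos hs0 hα01)
  have hbH : 0 < ((1 - σ) * α01 + σ * α11) := add_pos (mul_pos h1σ hα01) (mul_pos hσ0 hα11)
  have hτσ0 : 0 ≤ τ * σ := mul_nonneg hτ0.le hσ0.le
  have hπ0 : 0 ≤ (1 - τ) * (1 - s) * α00 := mul_nonneg (mul_nonneg h1τ.le h1s.le) hα00.le
  have hc0' : 0 ≤ c0 := le_trans (add_nonneg hτσ0 hπ0) hc0
  have hcτσ : τ * σ ≤ c0 := le_trans (le_add_of_nonneg_right hπ0) hc0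
  have hcd : 0 ≤ c0 - (τ * σ + (1 - τ) * (1 - s) * α00) := sub_nonneg.2 hc0
  have hα1' : α11 ≤ 1 := hα1
  have h1s1 : (1 - s) + s = 1 := by ring
  have h1σ1 : (1 - σ) + σ = 1 := by ring
  intro m0 m1 hm0 h0 h1 t ht0 ht1
  have hA : 0 ≤ (c0 + τ * (1 - σ) * ((1 - s) * α00)) := add_nonneg hc0' (mul_nonneg hp0.le (mul_nonneg h1s.le hα00.le))
  have hB : 0 < (τ * (1 - σ) * s + s * (1 - τ)) := add_pos (mul_pos hp0 hs0) hq0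
  have hb1 : (0:ℝ) ≤ 0 := le_rfl
  have hp1 : 0 < 0 * m0 + α00 := by rw [zero_mul, zero_add]; exact hα00
  have hr1 : (0:ℝ) = 0 ∨ α00 * (τ * (1 - σ) * s + s * (1 - τ)) ≤ (c0 + τ * (1 - σ) * ((1 - s) * α00)) * 0 := Or.inl rfl
  have hb2 : (0:ℝ) ≤ 1 := zero_le_one
  have hp2 : 0 < 1 * m0 + 0 := by rw [one_mul, add_zero]; exact hm0
  have hr2 : (1:ℝ) = 0 ∨ 0 * (τ * (1 - σ) * s + s * (1 - τ)) ≤ (c0 + τ * (1 - σ) * ((1 - s) * α00)) * 1 := Or.inr (by rw [zero_mul]; exact mul_nonneg hA hb2)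
  have hb3 : (0:ℝ) ≤ 1 := zero_le_one
  have hp3 : 0 < 1 * m0 + 0 := by rw [one_mul, add_zero]; exact hm0
  have hr3 : (1:ℝ) = 0 ∨ 0 * (τ * (1 - σ) * s + s * (1 - τ)) ≤ (c0 + τ * (1 - σ) * ((1 - s) * α00)) * 1 := Or.inr (by rw [zero_mul]; exact mul_nonneg hA hb3)
  have hb4 : (0:ℝ) ≤ 1 := zero_le_one
  have hp4 : 0 < 1 * m0 + 0 := by rw [one_mul, add_zero]; exact hm0
  have hr4 : (1:ℝ) = 0 ∨ 0 * (τ * (1 - σ) * s + s * (1 - τ)) ≤ (c0 + τ * (1 - σ) * ((1 - s) * α00)) * 1 := Or.inr (by rw [zero_mul]; exact mul_nonneg hA hb4)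
  have hb5 : (0:ℝ) ≤ s := hs0.le
  have hp5 : 0 < s * m0 + (1 - s) * α00 := add_pos (mul_pos hs0 hm0) (mul_pos h1s hα00)
  have hr5 : (s:ℝ) = 0 ∨ (1 - s) * α00 * (τ * (1 - σ) * s + s * (1 - τ)) ≤ (c0 + τ * (1 - σ) * ((1 - s) * α00)) * s := Or.inr (sub_nonneg.1 (by
    have e : (c0 + τ * (1 - σ) * ((1 - s) * α00)) * s - (1 - s) * α00 * (τ * (1 - σ) * s + s * (1 - τ)) = s * ((c0 - (τ * σ + (1 - τ) * (1 - s) * α00)) + τ * σ) := by ring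
    rw [e]; exact mul_nonneg hs0.le (add_nonneg hcd hτσ0)))
  have hb6 : (0:ℝ) ≤ ((1 - σ) + σ) := by rw [h1σ1]; exact zero_le_one
  have hp6 : 0 < ((1 - σ) + σ) * m0 + 0 := by rw [h1σ1, one_mul, add_zero]; exact hm0
  have hr6 : (((1 - σ) + σ):ℝ) = 0 ∨ 0 * (τ * (1 - σ) * s + s * (1 - τ)) ≤ (c0 + τ * (1 - σ) * ((1 - s) * α00)) * ((1 - σ) + σ) := Or.inr (by rw [zero_mul]; exact mul_nonneg hA hb6)
  have e0 : (c0 + τ * (1 - σ) * ((1 - s) * α00)) + (τ * (1 - σ) * s + s * (1 - τ)) * m0 ≤ C * ((0 * m0 + α00) / α00) ^ ly * ((1 * m0 + 0) / α01) ^ lk * ((1 * m0 + 0) / α01) ^ lg * ((1 * m0 + 0) / α11) ^ lh * ((s * m0 + (1 - s) * α00) / ((1 - s) * α00 + s * α01)) ^ lX * ((((1 - σ) + σ) * m0 + 0) / ((1 - σ) * α01 + σ * α11)) ^ lH := by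
    rw [show (0 * m0 + α00 : ℝ) = α00 by ring, show (1 * m0 + 0 : ℝ) = m0 by ring, show (s * m0 + (1 - s) * α00 : ℝ) = (1 - s) * α00 + s * m0 by ring, show (((1 - σ) + σ) * m0 + 0 : ℝ) = (1 - σ) * m0 + σ * m0 by ring, show (c0 + τ * (1 - σ) * ((1 - s) * α00)) + (τ * (1 - σ) * s + s * (1 - τ)) * m0 = (c0 + τ * (1 - σ) * ((1 - s) * α00 + s * m0) + s * (1 - τ) * ((1 - σ) * m0 + σ * m0)) by ring]
    exact h0
  have e1 : (c0 + τ * (1 - σ) * ((1 - s) * α00)) + (τ * (1 - σ) * s + s * (1 - τ)) * m1 ≤ C * ((0 * m1 + α00) / α00) ^ ly * ((1 * m1 + 0) / α01) ^ lk * ((1 * m1 + 0) / α01) ^ lg * ((1 * m1 + 0) / α11) ^ lh * ((s * m1 + (1 - s) * α00) / ((1 - s) * α00 + s * α01)) ^ lX * ((((1 - σ) + σ) * m1 + 0) / ((1 - σ) * α01 + σ * α11)) ^ lH := by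
    rw [show (0 * m1 + α00 : ℝ) = α00 by ring, show (1 * m1 + 0 : ℝ) = m1 by ring, show (s * m1 + (1 - s) * α00 : ℝ) = (1 - s) * α00 + s * m1 by ring, show (((1 - σ) + σ) * m1 + 0 : ℝ) = (1 - σ) * m1 + σ * m1 by ring, show (c0 + τ * (1 - σ) * ((1 - s) * α00)) + (τ * (1 - σ) * s + s * (1 - τ)) * m1 = (c0 + τ * (1 - σ) * ((1 - s) * α00 + s * m1) + s * (1 - τ) * ((1 - σ) * m1 + σ * m1)) by ring]
    exact h1
  have key := affine_le_prod6_rpow_of_endpoints hA hB hC0.le hm0 ht0 ht1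
    hb1 hα00 hly hp1 hr1 hb2 hα01 hlk hp2 hr2 hb3 hα01 hlg hp3 hr3
    hb4 hα11 hlh hp4 hr4 hb5 hbY hlX hp5 hr5 hb6 hbH hlH hp6 hr6 e0 e1
  rw [show (0 * t + α00 : ℝ) = α00 by ring, show (1 * t + 0 : ℝ) = t by ring, show (s * t + (1 - s) * α00 : ℝ) = (1 - s) * α00 + s * t by ring, show (((1 - σ) + σ) * t + 0 : ℝ) = (1 - σ) * t + σ * t by ring, show (c0 + τ * (1 - σ) * ((1 - s) * α00)) + (τ * (1 - σ) * s + s * (1 - τ)) * t = (c0 + τ * (1 - σ) * ((1 - s) * α00 + s * t) + s * (1 - τ) * ((1 - σ) * t + σ * t)) by ring] at key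
  exact key

/-- Box tied fibre `y = k = g`: petal `(t,t,t,h)`, `t ∈ [m₀, m₁]`, `m₀ > 0`, `h ≤ 1` (varying: `y,k,g`, Ȳ, H; needs `c₀ ≥ τσ`). [this work] -/
theorem bfib_ykg :
    ∀ h m0 m1 : ℝ, α11 ≤ h → h ≤ 1 → 0 < m0 →
      (c0 + τ * (1 - σ) * ((1 - s) * m0 + s * m0) + s * (1 - τ) * ((1 - σ) * m0 + σ * h)) ≤ C * (m0 / α00) ^ ly * (m0 / α01) ^ lk * (m0 / α01) ^ lg * (h / α11) ^ lh * (((1 - s) * m0 + s * m0) / ((1 - s) * α00 + s * α01)) ^ lX * (((1 - σ) * m0 + σ * h) / ((1 - σ) * α01 + σ * α11)) ^ lH →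
      (c0 + τ * (1 - σ) * ((1 - s) * m1 + s * m1) + s * (1 - τ) * ((1 - σ) * m1 + σ * h)) ≤ C * (m1 / α00) ^ ly * (m1 / α01) ^ lk * (m1 / α01) ^ lg * (h / α11) ^ lh * (((1 - s) * m1 + s * m1) / ((1 - s) * α00 + s * α01)) ^ lX * (((1 - σ) * m1 + σ * h) / ((1 - σ) * α01 + σ * α11)) ^ lH →
      ∀ t : ℝ, m0 ≤ t → t ≤ m1 → (c0 + τ * (1 - σ) * ((1 - s) * t + s * t) + s * (1 - τ) * ((1 - σ) * t + σ * h)) ≤ C * (t / α00) ^ ly * (t / α01) ^ lk * (t / α01) ^ lg * (h / α11) ^ lh * (((1 - s) * t + s * t) / ((1 - s) * α00 + s * α01)) ^ lX * (((1 - σ) * t + σ * h) / ((1 - σ) * α01 + σ * α11)) ^ lH := by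
  obtain ⟨hτ0, hτ1, hσ0, hσ1, hs0, hs1, hα00, h01, h11, hα1, hc0, hly, hlk, hlg, hlh, hlX, hlH, hC0⟩ := hP
  have hα01 : 0 < α01 := lt_of_lt_of_le hα00 h01
  have hα11 : 0 < α11 := lt_of_lt_of_le hα01 h11
  have h1σ : 0 < 1 - σ := sub_pos.2 hσ1
  have h1s : 0 < 1 - s := sub_pos.2 hs1
  have h1τ : 0 < 1 - τ := sub_pos.2 hτ1
  have hp0 : 0 < τ * (1 - σ) := mul_pos hτ0 h1σ
  have hq0 : 0 < s * (1 - τ) := mul_pos hs0 h1τ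
  have hbY : 0 < ((1 - s) * α00 + s * α01) := add_pos (mul_pos h1s hα00) (mul_pos hs0 hα01)
  have hbH : 0 < ((1 - σ) * α01 + σ * α11) := add_pos (mul_pos h1σ hα01) (mul_pos hσ0 hα11)
  have hτσ0 : 0 ≤ τ * σ := mul_nonneg hτ0.le hσ0.le
  have hπ0 : 0 ≤ (1 - τ) * (1 - s) * α00 := mul_nonneg (mul_nonneg h1τ.le h1s.le) hα00.le
  have hc0' : 0 ≤ c0 := le_trans (add_nonneg hτσ0 hπ0) hc0
  have hcτσ : τ * σ ≤ c0 := le_trans (le_add_of_nonneg_right hπ0) hc0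
  have hcd : 0 ≤ c0 - (τ * σ + (1 - τ) * (1 - s) * α00) := sub_nonneg.2 hc0
  have hα1' : α11 ≤ 1 := hα1
  have h1s1 : (1 - s) + s = 1 := by ring
  have h1σ1 : (1 - σ) + σ = 1 := by ring
  intro h m0 m1 hh hh1 hm0 h0 h1 t ht0 ht1
  have hhp : 0 < h := lt_of_lt_of_le hα11 hh
  have hh0 : 0 ≤ h := hhp.le
  have hA : 0 ≤ (c0 + s * (1 - τ) * (σ * h)) := add_nonneg hc0' (mul_nonneg hq0.le (mul_nonneg hσ0.le hh0))
  have hB : 0 < (τ * (1 - σ) + s * (1 - τ) * (1 - σ)) := add_pos hp0 (mul_pos hq0 h1σ)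
  have hb1 : (0:ℝ) ≤ 1 := zero_le_one
  have hp1 : 0 < 1 * m0 + 0 := by rw [one_mul, add_zero]; exact hm0
  have hr1 : (1:ℝ) = 0 ∨ 0 * (τ * (1 - σ) + s * (1 - τ) * (1 - σ)) ≤ (c0 + s * (1 - τ) * (σ * h)) * 1 := Or.inr (by rw [zero_mul]; exact mul_nonneg hA hb1)
  have hb2 : (0:ℝ) ≤ 1 := zero_le_one
  have hp2 : 0 < 1 * m0 + 0 := by rw [one_mul, add_zero]; exact hm0
  have hr2 : (1:ℝ) = 0 ∨ 0 * (τ * (1 - σ) + s * (1 - τ) * (1 - σ)) ≤ (c0 + s * (1 - τ) * (σ * h)) * 1 := Or.inr (by rw [zero_mul]; exact mul_nonneg hA hb2)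
  have hb3 : (0:ℝ) ≤ 1 := zero_le_one
  have hp3 : 0 < 1 * m0 + 0 := by rw [one_mul, add_zero]; exact hm0
  have hr3 : (1:ℝ) = 0 ∨ 0 * (τ * (1 - σ) + s * (1 - τ) * (1 - σ)) ≤ (c0 + s * (1 - τ) * (σ * h)) * 1 := Or.inr (by rw [zero_mul]; exact mul_nonneg hA hb3)
  have hb4 : (0:ℝ) ≤ 0 := le_rfl
  have hp4 : 0 < 0 * m0 + h := by rw [zero_mul, zero_add]; exact hhp
  have hr4 : (0:ℝ) = 0 ∨ h * (τ * (1 - σ) + s * (1 - τ) * (1 - σ)) ≤ (c0 + s * (1 - τ) * (σ * h)) * 0 := Or.inl rfl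
  have hb5 : (0:ℝ) ≤ ((1 - s) + s) := by rw [h1s1]; exact zero_le_one
  have hp5 : 0 < ((1 - s) + s) * m0 + 0 := by rw [h1s1, one_mul, add_zero]; exact hm0
  have hr5 : (((1 - s) + s):ℝ) = 0 ∨ 0 * (τ * (1 - σ) + s * (1 - τ) * (1 - σ)) ≤ (c0 + s * (1 - τ) * (σ * h)) * ((1 - s) + s) := Or.inr (by rw [zero_mul]; exact mul_nonneg hA hb5)
  have hb6 : (0:ℝ) ≤ (1 - σ) := h1σ.le
  have hp6 : 0 < (1 - σ) * m0 + σ * h := add_pos (mul_pos h1σ hm0) (mul_pos hσ0 hhp)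
  have hr6 : ((1 - σ):ℝ) = 0 ∨ σ * h * (τ * (1 - σ) + s * (1 - τ) * (1 - σ)) ≤ (c0 + s * (1 - τ) * (σ * h)) * (1 - σ) := Or.inr (sub_nonneg.1 (by
    have e : (c0 + s * (1 - τ) * (σ * h)) * (1 - σ) - σ * h * (τ * (1 - σ) + s * (1 - τ) * (1 - σ)) = (1 - σ) * ((c0 - τ * σ) + τ * σ * (1 - h)) := by ring
    rw [e]; exact mul_nonneg h1σ.le (add_nonneg (sub_nonneg.2 hcτσ) (mul_nonneg hτσ0 (sub_nonneg.2 hh1)))))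
  have e0 : (c0 + s * (1 - τ) * (σ * h)) + (τ * (1 - σ) + s * (1 - τ) * (1 - σ)) * m0 ≤ C * ((1 * m0 + 0) / α00) ^ ly * ((1 * m0 + 0) / α01) ^ lk * ((1 * m0 + 0) / α01) ^ lg * ((0 * m0 + h) / α11) ^ lh * ((((1 - s) + s) * m0 + 0) / ((1 - s) * α00 + s * α01)) ^ lX * (((1 - σ) * m0 + σ * h) / ((1 - σ) * α01 + σ * α11)) ^ lH := by
    rw [show (1 * m0 + 0 : ℝ) = m0 by ring, show (0 * m0 + h : ℝ) = h by ring, show (((1 - s) + s) * m0 + 0 : ℝ) = (1 - s) * m0 + s * m0 by ring, show (c0 + s * (1 - τ) * (σ * h)) + (τ * (1 - σ) + s * (1 - τ) * (1 - σ)) * m0 = (c0 + τ * (1 - σ) * ((1 - s) * m0 + s * m0) + s * (1 - τ) * ((1 - σ) * m0 + σ * h)) by ring]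
    exact h0
  have e1 : (c0 + s * (1 - τ) * (σ * h)) + (τ * (1 - σ) + s * (1 - τ) * (1 - σ)) * m1 ≤ C * ((1 * m1 + 0) / α00) ^ ly * ((1 * m1 + 0) / α01) ^ lk * ((1 * m1 + 0) / α01) ^ lg * ((0 * m1 + h) / α11) ^ lh * ((((1 - s) + s) * m1 + 0) / ((1 - s) * α00 + s * α01)) ^ lX * (((1 - σ) * m1 + σ * h) / ((1 - σ) * α01 + σ * α11)) ^ lH := by
    rw [show (1 * m1 + 0 : ℝ) = m1 by ring, show (0 * m1 + h : ℝ) = h by ring, show (((1 - s) + s) * m1 + 0 : ℝ) = (1 - s) * m1 + s * m1 by ring, show (c0 + s * (1 - τ) * (σ * h)) + (τ * (1 - σ) + s * (1 - τ) * (1 - σ)) * m1 = (c0 + τ * (1 - σ) * ((1 - s) * m1 + s * m1) + s * (1 - τ) * ((1 - σ) * m1 + σ * h)) by ring]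
    exact h1
  have key := affine_le_prod6_rpow_of_endpoints hA hB hC0.le hm0 ht0 ht1
    hb1 hα00 hly hp1 hr1 hb2 hα01 hlk hp2 hr2 hb3 hα01 hlg hp3 hr3
    hb4 hα11 hlh hp4 hr4 hb5 hbY hlX hp5 hr5 hb6 hbH hlH hp6 hr6 e0 e1
  rw [show (1 * t + 0 : ℝ) = t by ring, show (0 * t + h : ℝ) = h by ring, show (((1 - s) + s) * t + 0 : ℝ) = (1 - s) * t + s * t by ring, show (c0 + s * (1 - τ) * (σ * h)) + (τ * (1 - σ) + s * (1 - τ) * (1 - σ)) * t = (c0 + τ * (1 - σ) * ((1 - s) * t + s * t) + s * (1 - τ) * ((1 - σ) * t + σ * h)) by ring] at key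
  exact key

/-- Box main diagonal: petal `(t,t,t,t)`, `t ∈ [m₀, m₁]`, `m₀ > 0` (all usages proportional to `t`). [this work] -/
theorem bfib_all :
    ∀ m0 m1 : ℝ, 0 < m0 →
      (c0 + τ * (1 - σ) * ((1 - s) * m0 + s * m0) + s * (1 - τ) * ((1 - σ) * m0 + σ * m0)) ≤ C * (m0 / α00) ^ ly * (m0 / α01) ^ lk * (m0 / α01) ^ lg * (m0 / α11) ^ lh * (((1 - s) * m0 + s * m0) / ((1 - s) * α00 + s * α01)) ^ lX * (((1 - σ) * m0 + σ * m0) / ((1 - σ) * α01 + σ * α11)) ^ lH →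
      (c0 + τ * (1 - σ) * ((1 - s) * m1 + s * m1) + s * (1 - τ) * ((1 - σ) * m1 + σ * m1)) ≤ C * (m1 / α00) ^ ly * (m1 / α01) ^ lk * (m1 / α01) ^ lg * (m1 / α11) ^ lh * (((1 - s) * m1 + s * m1) / ((1 - s) * α00 + s * α01)) ^ lX * (((1 - σ) * m1 + σ * m1) / ((1 - σ) * α01 + σ * α11)) ^ lH →
      ∀ t : ℝ, m0 ≤ t → t ≤ m1 → (c0 + τ * (1 - σ) * ((1 - s) * t + s * t) + s * (1 - τ) * ((1 - σ) * t + σ * t)) ≤ C * (t / α00) ^ ly * (t / α01) ^ lk * (t / α01) ^ lg * (t / α11) ^ lh * (((1 - s) * t + s * t) / ((1 - s) * α00 + s * α01)) ^ lX * (((1 - σ) * t + σ * t) / ((1 - σ) * α01 + σ * α11)) ^ lH := by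
  obtain ⟨hτ0, hτ1, hσ0, hσ1, hs0, hs1, hα00, h01, h11, hα1, hc0, hly, hlk, hlg, hlh, hlX, hlH, hC0⟩ := hP
  have hα01 : 0 < α01 := lt_of_lt_of_le hα00 h01
  have hα11 : 0 < α11 := lt_of_lt_of_le hα01 h11
  have h1σ : 0 < 1 - σ := sub_pos.2 hσ1
  have h1s : 0 < 1 - s := sub_pos.2 hs1
  have h1τ : 0 < 1 - τ := sub_pos.2 hτ1
  have hp0 : 0 < τ * (1 - σ) := mul_pos hτ0 h1σ
  have hq0 : 0 < s * (1 - τ) := mul_pos hs0 h1τ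
  have hbY : 0 < ((1 - s) * α00 + s * α01) := add_pos (mul_pos h1s hα00) (mul_pos hs0 hα01)
  have hbH : 0 < ((1 - σ) * α01 + σ * α11) := add_pos (mul_pos h1σ hα01) (mul_pos hσ0 hα11)
  have hτσ0 : 0 ≤ τ * σ := mul_nonneg hτ0.le hσ0.le
  have hπ0 : 0 ≤ (1 - τ) * (1 - s) * α00 := mul_nonneg (mul_nonneg h1τ.le h1s.le) hα00.le
  have hc0' : 0 ≤ c0 := le_trans (add_nonneg hτσ0 hπ0) hc0
  have hcτσ : τ * σ ≤ c0 := le_trans (le_add_of_nonneg_right hπ0) hc0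
  have hcd : 0 ≤ c0 - (τ * σ + (1 - τ) * (1 - s) * α00) := sub_nonneg.2 hc0
  have hα1' : α11 ≤ 1 := hα1
  have h1s1 : (1 - s) + s = 1 := by ring
  have h1σ1 : (1 - σ) + σ = 1 := by ring
  intro m0 m1 hm0 h0 h1 t ht0 ht1
  have hA : 0 ≤ (c0) := hc0'
  have hB : 0 < (τ * (1 - σ) + s * (1 - τ)) := add_pos hp0 hq0
  have hb1 : (0:ℝ) ≤ 1 := zero_le_one
  have hp1 : 0 < 1 * m0 + 0 := by rw [one_mul, add_zero]; exact hm0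
  have hr1 : (1:ℝ) = 0 ∨ 0 * (τ * (1 - σ) + s * (1 - τ)) ≤ (c0) * 1 := Or.inr (by rw [zero_mul]; exact mul_nonneg hA hb1)
  have hb2 : (0:ℝ) ≤ 1 := zero_le_one
  have hp2 : 0 < 1 * m0 + 0 := by rw [one_mul, add_zero]; exact hm0
  have hr2 : (1:ℝ) = 0 ∨ 0 * (τ * (1 - σ) + s * (1 - τ)) ≤ (c0) * 1 := Or.inr (by rw [zero_mul]; exact mul_nonneg hA hb2)
  have hb3 : (0:ℝ) ≤ 1 := zero_le_one
  have hp3 : 0 < 1 * m0 + 0 := by rw [one_mul, add_zero]; exact hm0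
  have hr3 : (1:ℝ) = 0 ∨ 0 * (τ * (1 - σ) + s * (1 - τ)) ≤ (c0) * 1 := Or.inr (by rw [zero_mul]; exact mul_nonneg hA hb3)
  have hb4 : (0:ℝ) ≤ 1 := zero_le_one
  have hp4 : 0 < 1 * m0 + 0 := by rw [one_mul, add_zero]; exact hm0
  have hr4 : (1:ℝ) = 0 ∨ 0 * (τ * (1 - σ) + s * (1 - τ)) ≤ (c0) * 1 := Or.inr (by rw [zero_mul]; exact mul_nonneg hA hb4)
  have hb5 : (0:ℝ) ≤ ((1 - s) + s) := by rw [h1s1]; exact zero_le_one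
  have hp5 : 0 < ((1 - s) + s) * m0 + 0 := by rw [h1s1, one_mul, add_zero]; exact hm0
  have hr5 : (((1 - s) + s):ℝ) = 0 ∨ 0 * (τ * (1 - σ) + s * (1 - τ)) ≤ (c0) * ((1 - s) + s) := Or.inr (by rw [zero_mul]; exact mul_nonneg hA hb5)
  have hb6 : (0:ℝ) ≤ ((1 - σ) + σ) := by rw [h1σ1]; exact zero_le_one
  have hp6 : 0 < ((1 - σ) + σ) * m0 + 0 := by rw [h1σ1, one_mul, add_zero]; exact hm0
  have hr6 : (((1 - σ) + σ):ℝ) = 0 ∨ 0 * (τ * (1 - σ) + s * (1 - τ)) ≤ (c0) * ((1 - σ) + σ) := Or.inr (by rw [zero_mul]; exact mul_nonneg hA hb6)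
  have e0 : (c0) + (τ * (1 - σ) + s * (1 - τ)) * m0 ≤ C * ((1 * m0 + 0) / α00) ^ ly * ((1 * m0 + 0) / α01) ^ lk * ((1 * m0 + 0) / α01) ^ lg * ((1 * m0 + 0) / α11) ^ lh * ((((1 - s) + s) * m0 + 0) / ((1 - s) * α00 + s * α01)) ^ lX * ((((1 - σ) + σ) * m0 + 0) / ((1 - σ) * α01 + σ * α11)) ^ lH := by
    rw [show (1 * m0 + 0 : ℝ) = m0 by ring, show (((1 - s) + s) * m0 + 0 : ℝ) = (1 - s) * m0 + s * m0 by ring, show (((1 - σ) + σ) * m0 + 0 : ℝ) = (1 - σ) * m0 + σ * m0 by ring, show (c0) + (τ * (1 - σ) + s * (1 - τ)) * m0 = (c0 + τ * (1 - σ) * ((1 - s) * m0 + s * m0) + s * (1 - τ) * ((1 - σ) * m0 + σ * m0)) by ring]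
    exact h0
  have e1 : (c0) + (τ * (1 - σ) + s * (1 - τ)) * m1 ≤ C * ((1 * m1 + 0) / α00) ^ ly * ((1 * m1 + 0) / α01) ^ lk * ((1 * m1 + 0) / α01) ^ lg * ((1 * m1 + 0) / α11) ^ lh * ((((1 - s) + s) * m1 + 0) / ((1 - s) * α00 + s * α01)) ^ lX * ((((1 - σ) + σ) * m1 + 0) / ((1 - σ) * α01 + σ * α11)) ^ lH := by
    rw [show (1 * m1 + 0 : ℝ) = m1 by ring, show (((1 - s) + s) * m1 + 0 : ℝ) = (1 - s) * m1 + s * m1 by ring, show (((1 - σ) + σ) * m1 + 0 : ℝ) = (1 - σ) * m1 + σ * m1 by ring, show (c0) + (τ * (1 - σ) + s * (1 - τ)) * m1 = (c0 + τ * (1 - σ) * ((1 - s) * m1 + s * m1) + s * (1 - τ) * ((1 - σ) * m1 + σ * m1)) by ring]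
    exact h1
  have key := affine_le_prod6_rpow_of_endpoints hA hB hC0.le hm0 ht0 ht1
    hb1 hα00 hly hp1 hr1 hb2 hα01 hlk hp2 hr2 hb3 hα01 hlg hp3 hr3
    hb4 hα11 hlh hp4 hr4 hb5 hbY hlX hp5 hr5 hb6 hbH hlH hp6 hr6 e0 e1
  rw [show (1 * t + 0 : ℝ) = t by ring, show (((1 - s) + s) * t + 0 : ℝ) = (1 - s) * t + s * t by ring, show (((1 - σ) + σ) * t + 0 : ℝ) = (1 - σ) * t + σ * t by ring, show (c0) + (τ * (1 - σ) + s * (1 - τ)) * t = (c0 + τ * (1 - σ) * ((1 - s) * t + s * t) + s * (1 - τ) * ((1 - σ) * t + σ * t)) by ring] at key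
  exact key

/-- Box tied fibre `g = h`: petal `(y,k,t,t)`, `t ∈ [m₀, m₁]`, `m₀ > 0` (varying: `g,h`, H — proportional to `t`). [this work] -/
theorem bfib_gh :
    ∀ y k m0 m1 : ℝ, α00 ≤ y → α01 ≤ k → 0 < m0 →
      (c0 + τ * (1 - σ) * ((1 - s) * y + s * k) + s * (1 - τ) * ((1 - σ) * m0 + σ * m0)) ≤ C * (y / α00) ^ ly * (k / α01) ^ lk * (m0 / α01) ^ lg * (m0 / α11) ^ lh * (((1 - s) * y + s * k) / ((1 - s) * α00 + s * α01)) ^ lX * (((1 - σ) * m0 + σ * m0) / ((1 - σ) * α01 + σ * α11)) ^ lH →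
      (c0 + τ * (1 - σ) * ((1 - s) * y + s * k) + s * (1 - τ) * ((1 - σ) * m1 + σ * m1)) ≤ C * (y / α00) ^ ly * (k / α01) ^ lk * (m1 / α01) ^ lg * (m1 / α11) ^ lh * (((1 - s) * y + s * k) / ((1 - s) * α00 + s * α01)) ^ lX * (((1 - σ) * m1 + σ * m1) / ((1 - σ) * α01 + σ * α11)) ^ lH →
      ∀ t : ℝ, m0 ≤ t → t ≤ m1 → (c0 + τ * (1 - σ) * ((1 - s) * y + s * k) + s * (1 - τ) * ((1 - σ) * t + σ * t)) ≤ C * (y / α00) ^ ly * (k / α01) ^ lk * (t / α01) ^ lg * (t / α11) ^ lh * (((1 - s) * y + s * k) / ((1 - s) * α00 + s * α01)) ^ lX * (((1 - σ) * t + σ * t) / ((1 - σ) * α01 + σ * α11)) ^ lH := by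
  obtain ⟨hτ0, hτ1, hσ0, hσ1, hs0, hs1, hα00, h01, h11, hα1, hc0, hly, hlk, hlg, hlh, hlX, hlH, hC0⟩ := hP
  have hα01 : 0 < α01 := lt_of_lt_of_le hα00 h01
  have hα11 : 0 < α11 := lt_of_lt_of_le hα01 h11
  have h1σ : 0 < 1 - σ := sub_pos.2 hσ1
  have h1s : 0 < 1 - s := sub_pos.2 hs1
  have h1τ : 0 < 1 - τ := sub_pos.2 hτ1
  have hp0 : 0 < τ * (1 - σ) := mul_pos hτ0 h1σ
  have hq0 : 0 < s * (1 - τ) := mul_pos hs0 h1τ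
  have hbY : 0 < ((1 - s) * α00 + s * α01) := add_pos (mul_pos h1s hα00) (mul_pos hs0 hα01)
  have hbH : 0 < ((1 - σ) * α01 + σ * α11) := add_pos (mul_pos h1σ hα01) (mul_pos hσ0 hα11)
  have hτσ0 : 0 ≤ τ * σ := mul_nonneg hτ0.le hσ0.le
  have hπ0 : 0 ≤ (1 - τ) * (1 - s) * α00 := mul_nonneg (mul_nonneg h1τ.le h1s.le) hα00.le
  have hc0' : 0 ≤ c0 := le_trans (add_nonneg hτσ0 hπ0) hc0
  have hcτσ : τ * σ ≤ c0 := le_trans (le_add_of_nonneg_right hπ0) hc0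
  have hcd : 0 ≤ c0 - (τ * σ + (1 - τ) * (1 - s) * α00) := sub_nonneg.2 hc0
  have hα1' : α11 ≤ 1 := hα1
  have h1s1 : (1 - s) + s = 1 := by ring
  have h1σ1 : (1 - σ) + σ = 1 := by ring
  intro y k m0 m1 hy hk hm0 h0 h1 t ht0 ht1
  have hyp : 0 < y := lt_of_lt_of_le hα00 hy
  have hkp : 0 < k := lt_of_lt_of_le hα01 hk
  have hy0 : 0 ≤ y := hyp.le
  have hk0 : 0 ≤ k := hkp.le
  have hA : 0 ≤ (c0 + τ * (1 - σ) * ((1 - s) * y + s * k)) := add_nonneg hc0' (mul_nonneg hp0.le (add_nonneg (mul_nonneg h1s.le hy0) (mul_nonneg hs0.le hk0)))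
  have hB : 0 < (s * (1 - τ)) := hq0
  have hb1 : (0:ℝ) ≤ 0 := le_rfl
  have hp1 : 0 < 0 * m0 + y := by rw [zero_mul, zero_add]; exact hyp
  have hr1 : (0:ℝ) = 0 ∨ y * (s * (1 - τ)) ≤ (c0 + τ * (1 - σ) * ((1 - s) * y + s * k)) * 0 := Or.inl rfl
  have hb2 : (0:ℝ) ≤ 0 := le_rfl
  have hp2 : 0 < 0 * m0 + k := by rw [zero_mul, zero_add]; exact hkp
  have hr2 : (0:ℝ) = 0 ∨ k * (s * (1 - τ)) ≤ (c0 + τ * (1 - σ) * ((1 - s) * y + s * k)) * 0 := Or.inl rfl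
  have hb3 : (0:ℝ) ≤ 1 := zero_le_one
  have hp3 : 0 < 1 * m0 + 0 := by rw [one_mul, add_zero]; exact hm0
  have hr3 : (1:ℝ) = 0 ∨ 0 * (s * (1 - τ)) ≤ (c0 + τ * (1 - σ) * ((1 - s) * y + s * k)) * 1 := Or.inr (by rw [zero_mul]; exact mul_nonneg hA hb3)
  have hb4 : (0:ℝ) ≤ 1 := zero_le_one
  have hp4 : 0 < 1 * m0 + 0 := by rw [one_mul, add_zero]; exact hm0
  have hr4 : (1:ℝ) = 0 ∨ 0 * (s * (1 - τ)) ≤ (c0 + τ * (1 - σ) * ((1 - s) * y + s * k)) * 1 := Or.inr (by rw [zero_mul]; exact mul_nonneg hA hb4)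
  have hb5 : (0:ℝ) ≤ 0 := le_rfl
  have hp5 : 0 < 0 * m0 + ((1 - s) * y + s * k) := by rw [zero_mul, zero_add]; exact (add_pos (mul_pos h1s hyp) (mul_pos hs0 hkp))
  have hr5 : (0:ℝ) = 0 ∨ ((1 - s) * y + s * k) * (s * (1 - τ)) ≤ (c0 + τ * (1 - σ) * ((1 - s) * y + s * k)) * 0 := Or.inl rfl
  have hb6 : (0:ℝ) ≤ ((1 - σ) + σ) := by rw [h1σ1]; exact zero_le_one
  have hp6 : 0 < ((1 - σ) + σ) * m0 + 0 := by rw [h1σ1, one_mul, add_zero]; exact hm0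
  have hr6 : (((1 - σ) + σ):ℝ) = 0 ∨ 0 * (s * (1 - τ)) ≤ (c0 + τ * (1 - σ) * ((1 - s) * y + s * k)) * ((1 - σ) + σ) := Or.inr (by rw [zero_mul]; exact mul_nonneg hA hb6)
  have e0 : (c0 + τ * (1 - σ) * ((1 - s) * y + s * k)) + (s * (1 - τ)) * m0 ≤ C * ((0 * m0 + y) / α00) ^ ly * ((0 * m0 + k) / α01) ^ lk * ((1 * m0 + 0) / α01) ^ lg * ((1 * m0 + 0) / α11) ^ lh * ((0 * m0 + ((1 - s) * y + s * k)) / ((1 - s) * α00 + s * α01)) ^ lX * ((((1 - σ) + σ) * m0 + 0) / ((1 - σ) * α01 + σ * α11)) ^ lH := by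
    rw [show (0 * m0 + y : ℝ) = y by ring, show (0 * m0 + k : ℝ) = k by ring, show (1 * m0 + 0 : ℝ) = m0 by ring, show (0 * m0 + ((1 - s) * y + s * k) : ℝ) = (1 - s) * y + s * k by ring, show (((1 - σ) + σ) * m0 + 0 : ℝ) = (1 - σ) * m0 + σ * m0 by ring, show (c0 + τ * (1 - σ) * ((1 - s) * y + s * k)) + (s * (1 - τ)) * m0 = (c0 + τ * (1 - σ) * ((1 - s) * y + s * k) + s * (1 - τ) * ((1 - σ) * m0 + σ * m0)) by ring]
    exact h0
  have e1 : (c0 + τ * (1 - σ) * ((1 - s) * y + s * k)) + (s * (1 - τ)) * m1 ≤ C * ((0 * m1 + y) / α00) ^ ly * ((0 * m1 + k) / α01) ^ lk * ((1 * m1 + 0) / α01) ^ lg * ((1 * m1 + 0) / α11) ^ lh * ((0 * m1 + ((1 - s) * y + s * k)) / ((1 - s) * α00 + s * α01)) ^ lX * ((((1 - σ) + σ) * m1 + 0) / ((1 - σ) * α01 + σ * α11)) ^ lH := by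
    rw [show (0 * m1 + y : ℝ) = y by ring, show (0 * m1 + k : ℝ) = k by ring, show (1 * m1 + 0 : ℝ) = m1 by ring, show (0 * m1 + ((1 - s) * y + s * k) : ℝ) = (1 - s) * y + s * k by ring, show (((1 - σ) + σ) * m1 + 0 : ℝ) = (1 - σ) * m1 + σ * m1 by ring, show (c0 + τ * (1 - σ) * ((1 - s) * y + s * k)) + (s * (1 - τ)) * m1 = (c0 + τ * (1 - σ) * ((1 - s) * y + s * k) + s * (1 - τ) * ((1 - σ) * m1 + σ * m1)) by ring]
    exact h1
  have key := affine_le_prod6_rpow_of_endpoints hA hB hC0.le hm0 ht0 ht1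
    hb1 hα00 hly hp1 hr1 hb2 hα01 hlk hp2 hr2 hb3 hα01 hlg hp3 hr3
    hb4 hα11 hlh hp4 hr4 hb5 hbY hlX hp5 hr5 hb6 hbH hlH hp6 hr6 e0 e1
  rw [show (0 * t + y : ℝ) = y by ring, show (0 * t + k : ℝ) = k by ring, show (1 * t + 0 : ℝ) = t by ring, show (0 * t + ((1 - s) * y + s * k) : ℝ) = (1 - s) * y + s * k by ring, show (((1 - σ) + σ) * t + 0 : ℝ) = (1 - σ) * t + σ * t by ring, show (c0 + τ * (1 - σ) * ((1 - s) * y + s * k)) + (s * (1 - τ)) * t = (c0 + τ * (1 - σ) * ((1 - s) * y + s * k) + s * (1 - τ) * ((1 - σ) * t + σ * t)) by ring] at key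
  exact key

end BoxFibresB

end Summit.CriticalPhenomena.PercolationContinuityZ3.Theorems.SunflowerPartition.SafeCalc.LinkedCurrency
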